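import Mathlib.MeasureTheory.Integral.Prod
import Mathlib.MeasureTheory.Integral.Bochner.ContinuousLinearMap
import HarnessLib

/-!
# Venture YMGap, track Y3 FLOW-DATA — mean and row-variance of a kernel that is a second-order polynomial in the coupling
# up to a cubic remainder (abstract probability space; theorems only)

HONEST FRAMING: venture file of the cell `pub-ymgap` (QuantumFields programme), track Y3 (FLOW-DATA); an abstract
measure-theoretic lemma (no lattice object), the bookkeeping step between `FlowData/RankOneSecondOrder.lean`
(`λ_max ≈ ⟪1,T1⟫ + ‖T1 − ⟪1,T1⟫1‖²`) and the second-order strong-coupling laws of the tube: if a kernel `K` on a probability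
space satisfies `|K(a,b) − 1 − J φ₁(a,b) − (J²/2) φ₂(a,b)| ≤ ε` pointwise with `|φ₁| ≤ c`, `|φ₂| ≤ c²`, then

* `abs_mean_sub_le` — the MEAN `t = ∫∫ K` satisfies `|t − (1 + J ∫∫φ₁ + (J²/2) ∫∫φ₂)| ≤ ε`;
* `abs_row_sub_le` — the centred ROW integrals satisfy `|(∫K(a,b)db − t) − J(∫φ₁(a,b)db − ∫∫φ₁)| ≤ J² c² + 2ε`;
* **`abs_rowVariance_sub_le`** — the ROW VARIANCE `v = ∫ (∫K(a,b)db − t)² da` satisfies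
  `|v − J² ∫ (∫φ₁(a,b)db − ∫∫φ₁)² da| ≤ (J²c² + 2ε)·(4|J|c + J²c² + 2ε)`.

All integrals are against the same probability measure; `K, φ₁, φ₂` jointly measurable and bounded. [folklore]
-/

noncomputable section

open MeasureTheory Function

namespace Summit.Ventures.YMGap.FlowData

section KernelExpansion

variable {X : Type*} [MeasurableSpace X] {μ : Measure X} [IsProbabilityMeasure μ]
  {K φ₁ φ₂ : X → X → ℝ} {J c ε CK : ℝ}

/-- A bounded measurable real function on a probability space is integrable. [folklore] -/
private theorem integrable_of_abs_le {f : X → ℝ} (hf : Measurable f) {C : ℝ} (hC : ∀ x, |f x| ≤ C) : Integrable f μ :=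
  Integrable.of_bound hf.aestronglyMeasurable C (ae_of_all _ fun x => by rw [Real.norm_eq_abs]; exact hC x)

/-- `|∫ f| ≤ C` if `|f| ≤ C` pointwise (probability measure). [folklore] -/
private theorem abs_integral_le_of_abs_le {f : X → ℝ} {C : ℝ} (hC : ∀ x, |f x| ≤ C) : |∫ x, f x ∂μ| ≤ C := by
  have h := norm_integral_le_of_norm_le_const (μ := μ) (f := f) (C := C) (ae_of_all _ fun x => by
    rw [Real.norm_eq_abs]; exact hC x)
  rwa [Real.norm_eq_abs, probReal_univ, mul_one] at h

/-- Measurability of a row integral `a ↦ ∫ F(a,b) db` of a jointly measurable function. [folklore] -/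
private theorem measurable_rowIntegral {F : X → X → ℝ} (hF : StronglyMeasurable (uncurry F)) :
    Measurable fun a => ∫ b, F a b ∂μ :=
  (MeasureTheory.StronglyMeasurable.integral_prod_right (ν := μ) hF).measurable

/-- **Mean of the kernel to second order**: `|∫∫K − (1 + J∫∫φ₁ + (J²/2)∫∫φ₂)| ≤ ε`. [folklore] -/
theorem abs_mean_sub_le (hK : StronglyMeasurable (uncurry K)) (hφ₁ : StronglyMeasurable (uncurry φ₁))
    (hφ₂ : StronglyMeasurable (uncurry φ₂)) (hKb : ∀ a b, |K a b| ≤ CK) (hφ₁b : ∀ a b, |φ₁ a b| ≤ c)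
    (hφ₂b : ∀ a b, |φ₂ a b| ≤ c ^ 2) (hrem : ∀ a b, |K a b - 1 - J * φ₁ a b - J ^ 2 / 2 * φ₂ a b| ≤ ε) :
    |(∫ a, ∫ b, K a b ∂μ ∂μ) - (1 + J * ∫ a, ∫ b, φ₁ a b ∂μ ∂μ + J ^ 2 / 2 * ∫ a, ∫ b, φ₂ a b ∂μ ∂μ)| ≤ ε := by
  -- row by row
  have hrow : ∀ a, |(∫ b, K a b ∂μ) - (1 + J * ∫ b, φ₁ a b ∂μ + J ^ 2 / 2 * ∫ b, φ₂ a b ∂μ)| ≤ ε := by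
    intro a
    have iK : Integrable (fun b => K a b) μ :=
      integrable_of_abs_le (hK.measurable.comp (measurable_const.prodMk measurable_id)) (fun b => hKb a b)
    have i1 : Integrable (fun b => φ₁ a b) μ :=
      integrable_of_abs_le (hφ₁.measurable.comp (measurable_const.prodMk measurable_id)) (fun b => hφ₁b a b)
    have i2 : Integrable (fun b => φ₂ a b) μ :=
      integrable_of_abs_le (hφ₂.measurable.comp (measurable_const.prodMk measurable_id)) (fun b => hφ₂b a b)
    have i1J : Integrable (fun b => J * φ₁ a b) μ := i1.const_mul J
    have i2J : Integrable (fun b => J ^ 2 / 2 * φ₂ a b) μ := i2.const_mul _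
    have iK1 : Integrable (fun b => K a b - 1) μ := iK.sub (integrable_const _)
    have iK1J : Integrable (fun b => K a b - 1 - J * φ₁ a b) μ := iK1.sub i1J
    have heq : (∫ b, K a b ∂μ) - (1 + J * ∫ b, φ₁ a b ∂μ + J ^ 2 / 2 * ∫ b, φ₂ a b ∂μ) =
        ∫ b, (K a b - 1 - J * φ₁ a b - J ^ 2 / 2 * φ₂ a b) ∂μ := by
      rw [integral_sub iK1J i2J, integral_sub iK1 i1J, integral_sub iK (integrable_const _),
        integral_const_mul, integral_const_mul, integral_const, probReal_univ, one_smul]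
      ring
    rw [heq]
    exact abs_integral_le_of_abs_le fun b => hrem a b
  -- integrate the rows
  have mK : Measurable fun a => ∫ b, K a b ∂μ := measurable_rowIntegral hK
  have m1 : Measurable fun a => ∫ b, φ₁ a b ∂μ := measurable_rowIntegral hφ₁
  have m2 : Measurable fun a => ∫ b, φ₂ a b ∂μ := measurable_rowIntegral hφ₂
  have iK : Integrable (fun a => ∫ b, K a b ∂μ) μ :=
    integrable_of_abs_le mK fun a => abs_integral_le_of_abs_le fun b => hKb a b
  have i1 : Integrable (fun a => ∫ b, φ₁ a b ∂μ) μ :=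
    integrable_of_abs_le m1 fun a => abs_integral_le_of_abs_le fun b => hφ₁b a b
  have i2 : Integrable (fun a => ∫ b, φ₂ a b ∂μ) μ :=
    integrable_of_abs_le m2 fun a => abs_integral_le_of_abs_le fun b => hφ₂b a b
  have i1J : Integrable (fun a => J * ∫ b, φ₁ a b ∂μ) μ := i1.const_mul J
  have i2J : Integrable (fun a => J ^ 2 / 2 * ∫ b, φ₂ a b ∂μ) μ := i2.const_mul _
  have i01 : Integrable (fun a => (1 : ℝ) + J * ∫ b, φ₁ a b ∂μ) μ := (integrable_const _).add i1J
  have i012 : Integrable (fun a => (1 : ℝ) + J * ∫ b, φ₁ a b ∂μ + J ^ 2 / 2 * ∫ b, φ₂ a b ∂μ) μ := i01.add i2J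
  have heq : (∫ a, ∫ b, K a b ∂μ ∂μ) - (1 + J * ∫ a, ∫ b, φ₁ a b ∂μ ∂μ + J ^ 2 / 2 * ∫ a, ∫ b, φ₂ a b ∂μ ∂μ) =
      ∫ a, ((∫ b, K a b ∂μ) - (1 + J * ∫ b, φ₁ a b ∂μ + J ^ 2 / 2 * ∫ b, φ₂ a b ∂μ)) ∂μ := by
    rw [integral_sub iK i012, integral_add i01 i2J, integral_add (integrable_const _) i1J, integral_const_mul,
      integral_const_mul, integral_const, probReal_univ, one_smul]
  rw [heq]
  exact abs_integral_le_of_abs_le hrow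

/-- **Centred row integrals to first order**: with `t = ∫∫K`, `m₁ = ∫∫φ₁`,
`|(∫K(a,·) − t) − J(∫φ₁(a,·) − m₁)| ≤ J²c² + 2ε`. [folklore] -/
theorem abs_row_sub_le (hK : StronglyMeasurable (uncurry K)) (hφ₁ : StronglyMeasurable (uncurry φ₁))
    (hφ₂ : StronglyMeasurable (uncurry φ₂)) (hKb : ∀ a b, |K a b| ≤ CK) (hφ₁b : ∀ a b, |φ₁ a b| ≤ c)
    (hφ₂b : ∀ a b, |φ₂ a b| ≤ c ^ 2) (hrem : ∀ a b, |K a b - 1 - J * φ₁ a b - J ^ 2 / 2 * φ₂ a b| ≤ ε) (a : X) :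
    |((∫ b, K a b ∂μ) - ∫ a, ∫ b, K a b ∂μ ∂μ) - J * ((∫ b, φ₁ a b ∂μ) - ∫ a, ∫ b, φ₁ a b ∂μ ∂μ)| ≤
      J ^ 2 * c ^ 2 + 2 * ε := by
  have hmean := abs_mean_sub_le (μ := μ) hK hφ₁ hφ₂ hKb hφ₁b hφ₂b hrem
  -- the row `a` to second order
  have iK : Integrable (fun b => K a b) μ :=
    integrable_of_abs_le (hK.measurable.comp (measurable_const.prodMk measurable_id)) (fun b => hKb a b)
  have i1 : Integrable (fun b => φ₁ a b) μ :=
    integrable_of_abs_le (hφ₁.measurable.comp (measurable_const.prodMk measurable_id)) (fun b => hφ₁b a b)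
  have i2 : Integrable (fun b => φ₂ a b) μ :=
    integrable_of_abs_le (hφ₂.measurable.comp (measurable_const.prodMk measurable_id)) (fun b => hφ₂b a b)
  have hrow : |(∫ b, K a b ∂μ) - (1 + J * ∫ b, φ₁ a b ∂μ + J ^ 2 / 2 * ∫ b, φ₂ a b ∂μ)| ≤ ε := by
    have i1J : Integrable (fun b => J * φ₁ a b) μ := i1.const_mul J
    have i2J : Integrable (fun b => J ^ 2 / 2 * φ₂ a b) μ := i2.const_mul _
    have iK1 : Integrable (fun b => K a b - 1) μ := iK.sub (integrable_const _)
    have iK1J : Integrable (fun b => K a b - 1 - J * φ₁ a b) μ := iK1.sub i1J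
    have heq : (∫ b, K a b ∂μ) - (1 + J * ∫ b, φ₁ a b ∂μ + J ^ 2 / 2 * ∫ b, φ₂ a b ∂μ) =
        ∫ b, (K a b - 1 - J * φ₁ a b - J ^ 2 / 2 * φ₂ a b) ∂μ := by
      rw [integral_sub iK1J i2J, integral_sub iK1 i1J, integral_sub iK (integrable_const _),
        integral_const_mul, integral_const_mul, integral_const, probReal_univ, one_smul]
      ring
    rw [heq]
    exact abs_integral_le_of_abs_le fun b => hrem a b
  -- the two second-order terms are each `≤ (J²/2) c²`
  have h2a : |J ^ 2 / 2 * ∫ b, φ₂ a b ∂μ| ≤ J ^ 2 / 2 * c ^ 2 := by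
    rw [abs_mul, abs_of_nonneg (by positivity : (0 : ℝ) ≤ J ^ 2 / 2)]
    exact mul_le_mul_of_nonneg_left (abs_integral_le_of_abs_le fun b => hφ₂b a b) (by positivity)
  have h2m : |J ^ 2 / 2 * ∫ a, ∫ b, φ₂ a b ∂μ ∂μ| ≤ J ^ 2 / 2 * c ^ 2 := by
    rw [abs_mul, abs_of_nonneg (by positivity : (0 : ℝ) ≤ J ^ 2 / 2)]
    exact mul_le_mul_of_nonneg_left (abs_integral_le_of_abs_le fun a => abs_integral_le_of_abs_le fun b => hφ₂b a b)
      (by positivity)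
  -- combine
  have key : ((∫ b, K a b ∂μ) - ∫ a, ∫ b, K a b ∂μ ∂μ) - J * ((∫ b, φ₁ a b ∂μ) - ∫ a, ∫ b, φ₁ a b ∂μ ∂μ) =
      ((∫ b, K a b ∂μ) - (1 + J * ∫ b, φ₁ a b ∂μ + J ^ 2 / 2 * ∫ b, φ₂ a b ∂μ)) -
        ((∫ a, ∫ b, K a b ∂μ ∂μ) - (1 + J * ∫ a, ∫ b, φ₁ a b ∂μ ∂μ + J ^ 2 / 2 * ∫ a, ∫ b, φ₂ a b ∂μ ∂μ)) +
        (J ^ 2 / 2 * ∫ b, φ₂ a b ∂μ) - (J ^ 2 / 2 * ∫ a, ∫ b, φ₂ a b ∂μ ∂μ) := by ring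
  rw [key]
  obtain ⟨h1l, h1u⟩ := abs_le.1 hrow
  obtain ⟨h2l, h2u⟩ := abs_le.1 hmean
  obtain ⟨h3l, h3u⟩ := abs_le.1 h2a
  obtain ⟨h4l, h4u⟩ := abs_le.1 h2m
  exact abs_le.2 ⟨by linarith, by linarith⟩

/-- **Row variance to second order**: with `t = ∫∫K`, `m₁ = ∫∫φ₁`,
`|∫ (∫K(a,·) − t)² da − J² ∫ (∫φ₁(a,·) − m₁)² da| ≤ (J²c² + 2ε)(4|J|c + J²c² + 2ε)`. [folklore] -/
theorem abs_rowVariance_sub_le (hK : StronglyMeasurable (uncurry K)) (hφ₁ : StronglyMeasurable (uncurry φ₁))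
    (hφ₂ : StronglyMeasurable (uncurry φ₂)) (hKb : ∀ a b, |K a b| ≤ CK) (hφ₁b : ∀ a b, |φ₁ a b| ≤ c)
    (hφ₂b : ∀ a b, |φ₂ a b| ≤ c ^ 2) (hrem : ∀ a b, |K a b - 1 - J * φ₁ a b - J ^ 2 / 2 * φ₂ a b| ≤ ε) :
    |(∫ a, ((∫ b, K a b ∂μ) - ∫ a, ∫ b, K a b ∂μ ∂μ) ^ 2 ∂μ) -
        J ^ 2 * ∫ a, ((∫ b, φ₁ a b ∂μ) - ∫ a, ∫ b, φ₁ a b ∂μ ∂μ) ^ 2 ∂μ| ≤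
      (J ^ 2 * c ^ 2 + 2 * ε) * (4 * |J| * c + (J ^ 2 * c ^ 2 + 2 * ε)) := by
  set t : ℝ := ∫ a, ∫ b, K a b ∂μ ∂μ with ht
  set m : ℝ := ∫ a, ∫ b, φ₁ a b ∂μ ∂μ with hm
  set r : X → ℝ := fun a => (∫ b, K a b ∂μ) - t with hr
  set d : X → ℝ := fun a => (∫ b, φ₁ a b ∂μ) - m with hd
  obtain ⟨x₀⟩ : Nonempty X := nonempty_of_isProbabilityMeasure μ
  have hc0 : 0 ≤ c := (abs_nonneg _).trans (hφ₁b x₀ x₀)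
  have hε0 : 0 ≤ ε := (abs_nonneg _).trans (hrem x₀ x₀)
  -- pointwise: `|r − J d| ≤ J²c² + 2ε`, `|d| ≤ 2c`
  have hrd : ∀ a, |r a - J * d a| ≤ J ^ 2 * c ^ 2 + 2 * ε := fun a =>
    abs_row_sub_le (μ := μ) hK hφ₁ hφ₂ hKb hφ₁b hφ₂b hrem a
  have hdb : ∀ a, |d a| ≤ 2 * c := fun a => by
    rw [hd]
    calc |(∫ b, φ₁ a b ∂μ) - m| ≤ |∫ b, φ₁ a b ∂μ| + |m| := abs_sub _ _
      _ ≤ c + c := add_le_add (abs_integral_le_of_abs_le fun b => hφ₁b a b)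
          (abs_integral_le_of_abs_le fun a => abs_integral_le_of_abs_le fun b => hφ₁b a b)
      _ = 2 * c := by ring
  -- pointwise: `|r² − J²d²| = |r − Jd| |r + Jd| ≤ (J²c²+2ε)(4|J|c + J²c² + 2ε)`
  have hpt : ∀ a, |r a ^ 2 - J ^ 2 * d a ^ 2| ≤ (J ^ 2 * c ^ 2 + 2 * ε) * (4 * |J| * c + (J ^ 2 * c ^ 2 + 2 * ε)) := by
    intro a
    have h1 : r a ^ 2 - J ^ 2 * d a ^ 2 = (r a - J * d a) * (r a + J * d a) := by ring
    rw [h1, abs_mul]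
    refine mul_le_mul (hrd a) ?_ (abs_nonneg _) (by positivity)
    have h2 : r a + J * d a = (r a - J * d a) + 2 * (J * d a) := by ring
    rw [h2]
    calc |(r a - J * d a) + 2 * (J * d a)| ≤ |r a - J * d a| + |2 * (J * d a)| := abs_add_le _ _
      _ ≤ (J ^ 2 * c ^ 2 + 2 * ε) + 2 * (|J| * (2 * c)) := by
          rw [abs_mul, abs_two, abs_mul]
          exact add_le_add (hrd a) (mul_le_mul_of_nonneg_left (mul_le_mul_of_nonneg_left (hdb a) (abs_nonneg _)) zero_le_two)
      _ = 4 * |J| * c + (J ^ 2 * c ^ 2 + 2 * ε) := by ring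
  -- integrate
  have mr : Measurable r := (measurable_rowIntegral hK).sub measurable_const
  have md : Measurable d := (measurable_rowIntegral hφ₁).sub measurable_const
  have hrb : ∀ a, |r a| ≤ CK + |t| := fun a => by
    rw [hr]
    exact (abs_sub _ _).trans (add_le_add (abs_integral_le_of_abs_le fun b => hKb a b) le_rfl)
  have ir2 : Integrable (fun a => r a ^ 2) μ :=
    integrable_of_abs_le (mr.pow_const 2) (C := (CK + |t|) ^ 2) fun a => by
      rw [abs_pow]; exact pow_le_pow_left₀ (abs_nonneg _) (hrb a) 2
  have id2 : Integrable (fun a => J ^ 2 * d a ^ 2) μ :=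
    (integrable_of_abs_le (md.pow_const 2) (C := (2 * c) ^ 2) fun a => by
      rw [abs_pow]; exact pow_le_pow_left₀ (abs_nonneg _) (hdb a) 2).const_mul _
  have heq : (∫ a, r a ^ 2 ∂μ) - J ^ 2 * ∫ a, d a ^ 2 ∂μ = ∫ a, (r a ^ 2 - J ^ 2 * d a ^ 2) ∂μ := by
    rw [integral_sub ir2 id2, integral_const_mul]
  show |(∫ a, r a ^ 2 ∂μ) - J ^ 2 * ∫ a, d a ^ 2 ∂μ| ≤ _
  rw [heq]
  exact abs_integral_le_of_abs_le hpt

end KernelExpansion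

end Summit.Ventures.YMGap.FlowData
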